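import Summits.AtomisticToContinuum.FouriersLaw.Theorems.BondHeatUncertaintyLightConeBondHeatVirialBounds

/-!
# `N`-uniform statics for the bond-heat window laws, part D: a bond with bounded current fluctuation

Support file for item `stmt-AtomisticToContinuum-9123` (`BondHeatUncertainty.LightConeBondHeat`).  Conclusion of parts
A–C for the pinned anharmonic chain `pinnedChain ω₂ lam β γ` (all parameters `> 0`, `T > 0`):

* `pinnedChain_bond_six_le`: `∑_{l=k+1} ∫ (q_l − q_k)⁶ ρ ≤ 64 ∑_i ∫ q_i⁶ ρ`;
* `pinnedChain_integral_sq_bondCurrent_mul_gibbsDensity_le`: on a bond, `∫ j_k² ρ ≤ 2T ∫ r² ρ + 2Tβ² ∫ r⁶ ρ`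
  (`j_k² ≤ ½(p_k² + p_l²)V'(r)²`, Gaussian momentum identity, `V'(r)² ≤ 2r² + 2β²r⁶`);
* `pinnedChain_sum_integral_sq_bondCurrent_le`: `∑_{bonds} ∫ j_k² ρ ≤ N Z (2T² + 384β²T³/(lam ω₂))` — EXTENSIVE
  with an `N`-independent rate;
* **`pinnedChain_exists_bond_sq_bondCurrent_le`**: for every `N ≥ 2` some bond `(i, i+1)` has
  `∫ j_i² dμ_T ≤ 4T² + 768β²T³/(lam ω₂)` (averaging over the `N − 1 ≥ N/2` bonds).
This is the `N`-uniform static input of the window laws (S)/(S_lc) at a bulk bond; with `V_N(b,t) ≤ 2⟨j_b²⟩_T t²`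
(file `…LightConeBondHeatBondCorrelation`) it gives `LightConeBondHeat` on every `N`-INDEPENDENT window `[1, t₀]`.
-/

noncomputable section

open MeasureTheory

namespace Summit.AtomisticToContinuum.FouriersLaw.Theorems.LightConeBondHeat

open Literature.MathematicalPhysics.KineticTheory.HeatConduction
open Summit.AtomisticToContinuum.FouriersLaw.Theorems.SubdiffusiveBondHeat

variable {N : ℕ}

section Assembly

variable {ω₂ lam β : ℝ}

/-- **Sixth moments of the bond stretches**: `∑_{l=k+1} ∫ (q_l − q_k)⁶ e^{-H/T} ≤ 64 ∑_i ∫ q_i⁶ e^{-H/T}`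
(`(q_l − q_k)⁶ ≤ 32(q_k⁶ + q_l⁶)`, each site lies on at most two bonds). [folklore] -/
theorem pinnedChain_bond_six_le (hω : 0 < ω₂) (hl : 0 < lam) (hβ : 0 < β) (γ : ℝ) (N : ℕ) {T : ℝ} (hT : 0 < T) :
    (∑ k : Fin N, ∑ l : Fin N, if l.val = k.val + 1 then
        ∫ x, (x.1 l - x.1 k) ^ 6 * (pinnedChain ω₂ lam β γ).gibbsDensity N T x else 0) ≤
      64 * ∑ i : Fin N, ∫ x, x.1 i ^ 6 * (pinnedChain ω₂ lam β γ).gibbsDensity N T x := by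
  set P := pinnedChain ω₂ lam β γ with hP
  set ρ := P.gibbsDensity N T with hρ
  have hρ0 : ∀ x, 0 ≤ ρ x := fun x => (P.gibbsDensity_pos N T x).le
  set f : Fin N → ℝ := fun i => ∫ x, x.1 i ^ 6 * ρ x with hf
  have hI6 : ∀ i : Fin N, Integrable fun x => x.1 i ^ 6 * ρ x := fun i =>
    pinnedChain_integrable_position_pow_six_mul_gibbsDensity hω hl hβ.le γ N hT i
  have hf0 : ∀ i, 0 ≤ f i := fun i => integral_nonneg fun x => mul_nonneg (by positivity) (hρ0 x)
  have hbond : ∀ k l : Fin N, l.val = k.val + 1 → ∫ x, (x.1 l - x.1 k) ^ 6 * ρ x ≤ 32 * (f l + f k) := by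
    intro k l hlk
    have hint : Integrable fun x => 32 * (x.1 k ^ 6 + x.1 l ^ 6) * ρ x :=
      (((hI6 k).add (hI6 l)).const_mul 32).congr (Filter.Eventually.of_forall fun x => by simp only [Pi.add_apply]; ring)
    have hle : ∀ x, (x.1 l - x.1 k) ^ 6 * ρ x ≤ 32 * (x.1 k ^ 6 + x.1 l ^ 6) * ρ x := fun x =>
      mul_le_mul_of_nonneg_right (sub_pow_six_le (x.1 k) (x.1 l)) (hρ0 x)
    have e : ∫ x, 32 * (x.1 k ^ 6 + x.1 l ^ 6) * ρ x = 32 * (f l + f k) := by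
      have : (fun x => 32 * (x.1 k ^ 6 + x.1 l ^ 6) * ρ x) = fun x => 32 * (x.1 k ^ 6 * ρ x) + 32 * (x.1 l ^ 6 * ρ x) := by
        funext x; ring
      rw [this, integral_add ((hI6 k).const_mul 32) ((hI6 l).const_mul 32), integral_const_mul, integral_const_mul]
      simp only [hf]
      ring
    rw [← e]
    exact integral_mono (pinnedChain_integrable_bond_pow_six_mul_gibbsDensity hω hl.le hβ γ N hT hlk) hint hle
  calc (∑ k : Fin N, ∑ l : Fin N, if l.val = k.val + 1 then ∫ x, (x.1 l - x.1 k) ^ 6 * ρ x else 0)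
      ≤ ∑ k : Fin N, ∑ l : Fin N, if l.val = k.val + 1 then 32 * (f l + f k) else 0 := by
        refine Finset.sum_le_sum fun k _ => Finset.sum_le_sum fun l _ => ?_
        split_ifs with h
        · exact hbond k l h
        · exact le_rfl
    _ = 32 * ∑ k : Fin N, ∑ l : Fin N, if l.val = k.val + 1 then (f l + f k) else 0 := by
        rw [Finset.mul_sum]
        refine Finset.sum_congr rfl fun k _ => ?_
        rw [Finset.mul_sum]
        refine Finset.sum_congr rfl fun l _ => ?_
        split_ifs <;> simp
    _ ≤ 32 * (2 * ∑ i, f i) := by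
        have := sum_bond_ends_le N hf0
        linarith
    _ = 64 * ∑ i, f i := by ring

/-! ### The squared bond current -/

/-- **`⟨j_k²⟩ ≤ T⟨V'(r)²⟩ ≤ 2T⟨r²⟩ + 2Tβ²⟨r⁶⟩`** on a bond `l = k + 1` (weights `e^{-H/T}`): `j_k² ≤ ½(p_k² + p_l²)V'(r)²`,
the Gaussian identity `∫ p² G(q) e^{-H/T} = T ∫ G(q) e^{-H/T}` at the two sites, and `(r + βr³)² ≤ 2r² + 2β²r⁶`.
[folklore] -/
theorem pinnedChain_integral_sq_bondCurrent_mul_gibbsDensity_le (hω : 0 < ω₂) (hl : 0 ≤ lam) (hβ : 0 < β) (γ : ℝ)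
    (N : ℕ) {T : ℝ} (hT : 0 < T) {k l : Fin N} (hlk : l.val = k.val + 1) :
    ∫ x, ((pinnedChain ω₂ lam β γ).bondCurrent N k x) ^ 2 * (pinnedChain ω₂ lam β γ).gibbsDensity N T x ≤
      2 * T * (∫ x, (x.1 l - x.1 k) ^ 2 * (pinnedChain ω₂ lam β γ).gibbsDensity N T x) +
        2 * T * β ^ 2 * ∫ x, (x.1 l - x.1 k) ^ 6 * (pinnedChain ω₂ lam β γ).gibbsDensity N T x := by
  set P := pinnedChain ω₂ lam β γ with hP
  set ρ := P.gibbsDensity N T with hρ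
  have hρ0 : ∀ x, 0 ≤ ρ x := fun x => (P.gibbsDensity_pos N T x).le
  have hkl : k.val + 1 < N := hlk ▸ l.isLt
  have hl' : (⟨k.val + 1, hkl⟩ : Fin N) = l := Fin.ext hlk.symm
  -- the configurational weight `G(q) = V'(q_l - q_k)²`
  set G : (Fin N → ℝ) → ℝ := fun q => (deriv P.V (q l - q k)) ^ 2 with hG
  have hGc : Continuous G := by
    simp only [hG, hP, pinnedChain_deriv_V]
    fun_prop
  have hGle : ∀ x : PhaseSpace N, |G x.1| ≤ (3 + β) ^ 2 * (1 + P.hamiltonian N x) ^ 2 := fun x => by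
    rw [abs_of_nonneg (sq_nonneg _)]
    exact (pinnedChain_bond_bounds hω.le hl hβ.le γ N x hlk).2.2
  have hjG : ∀ x, (P.bondCurrent N k x) ^ 2 = (x.2 k + x.2 l) ^ 2 / 4 * G x.1 := by
    intro x
    rw [bondCurrent_eq_of_lt P hkl x, hl']
    simp only [hG]
    ring
  -- `∫ j² ρ ≤ ∫ ½ (p_k² + p_l²) G ρ = T ∫ G ρ`
  have hGint : Integrable fun x => G x.1 * ρ x :=
    (pinnedChain_integrable_momentum_pow_mul_posFun hω hl hβ.le γ N hT k hGc hGle).1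
  have hk2 : Integrable fun x => x.2 k ^ 2 * G x.1 * ρ x :=
    (pinnedChain_integrable_momentum_pow_mul_posFun hω hl hβ.le γ N hT k hGc hGle).2.2
  have hl2 : Integrable fun x => x.2 l ^ 2 * G x.1 * ρ x :=
    (pinnedChain_integrable_momentum_pow_mul_posFun hω hl hβ.le γ N hT l hGc hGle).2.2
  have ek : ∫ x, x.2 k ^ 2 * G x.1 * ρ x = T * ∫ x, G x.1 * ρ x :=
    pinnedChain_integral_momentum_sq_mul_posFun hω hl hβ.le γ N hT k hGc hGle
  have el : ∫ x, x.2 l ^ 2 * G x.1 * ρ x = T * ∫ x, G x.1 * ρ x :=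
    pinnedChain_integral_momentum_sq_mul_posFun hω hl hβ.le γ N hT l hGc hGle
  have hint : Integrable fun x => (x.2 k ^ 2 * G x.1 * ρ x + x.2 l ^ 2 * G x.1 * ρ x) / 2 := (hk2.add hl2).div_const 2
  have hle : ∀ x, (P.bondCurrent N k x) ^ 2 * ρ x ≤ (x.2 k ^ 2 * G x.1 * ρ x + x.2 l ^ 2 * G x.1 * ρ x) / 2 := by
    intro x
    rw [hjG x]
    have hG0 : 0 ≤ G x.1 := sq_nonneg _
    have hsq : (x.2 k + x.2 l) ^ 2 ≤ 2 * (x.2 k ^ 2 + x.2 l ^ 2) := by nlinarith [sq_nonneg (x.2 k - x.2 l)]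
    have := mul_le_mul_of_nonneg_right (mul_le_mul_of_nonneg_right hsq hG0) (hρ0 x)
    nlinarith
  have step1 : ∫ x, (P.bondCurrent N k x) ^ 2 * ρ x ≤ T * ∫ x, G x.1 * ρ x := by
    calc ∫ x, (P.bondCurrent N k x) ^ 2 * ρ x ≤ ∫ x, (x.2 k ^ 2 * G x.1 * ρ x + x.2 l ^ 2 * G x.1 * ρ x) / 2 :=
          integral_mono_of_nonneg (Filter.Eventually.of_forall fun x => mul_nonneg (sq_nonneg _) (hρ0 x)) hint
            (Filter.Eventually.of_forall hle)
      _ = T * ∫ x, G x.1 * ρ x := by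
          rw [integral_div, integral_add hk2 hl2, ek, el]
          ring
  -- `∫ G ρ ≤ 2 ∫ r² ρ + 2β² ∫ r⁶ ρ`
  have hI2 : Integrable fun x => (x.1 l - x.1 k) ^ 2 * ρ x :=
    pinnedChain_integrable_bond_sq_mul_gibbsDensity hω hl hβ.le γ N hT hlk
  have hI6 : Integrable fun x => (x.1 l - x.1 k) ^ 6 * ρ x :=
    pinnedChain_integrable_bond_pow_six_mul_gibbsDensity hω hl hβ γ N hT hlk
  have hint2 : Integrable fun x => 2 * ((x.1 l - x.1 k) ^ 2 * ρ x) + 2 * β ^ 2 * ((x.1 l - x.1 k) ^ 6 * ρ x) :=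
    (hI2.const_mul 2).add (hI6.const_mul (2 * β ^ 2))
  have hle2 : ∀ x, G x.1 * ρ x ≤ 2 * ((x.1 l - x.1 k) ^ 2 * ρ x) + 2 * β ^ 2 * ((x.1 l - x.1 k) ^ 6 * ρ x) := by
    intro x
    have hW : G x.1 ≤ 2 * (x.1 l - x.1 k) ^ 2 + 2 * β ^ 2 * (x.1 l - x.1 k) ^ 6 := by
      simp only [hG, hP, pinnedChain_deriv_V]
      nlinarith [sq_nonneg ((x.1 l - x.1 k) - β * (x.1 l - x.1 k) ^ 3)]
    have := mul_le_mul_of_nonneg_right hW (hρ0 x)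
    nlinarith
  have step2 : ∫ x, G x.1 * ρ x ≤ 2 * (∫ x, (x.1 l - x.1 k) ^ 2 * ρ x) + 2 * β ^ 2 * ∫ x, (x.1 l - x.1 k) ^ 6 * ρ x := by
    calc ∫ x, G x.1 * ρ x ≤ ∫ x, (2 * ((x.1 l - x.1 k) ^ 2 * ρ x) + 2 * β ^ 2 * ((x.1 l - x.1 k) ^ 6 * ρ x)) :=
          integral_mono hGint hint2 hle2
      _ = 2 * (∫ x, (x.1 l - x.1 k) ^ 2 * ρ x) + 2 * β ^ 2 * ∫ x, (x.1 l - x.1 k) ^ 6 * ρ x := by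
          rw [integral_add (hI2.const_mul 2) (hI6.const_mul (2 * β ^ 2)), integral_const_mul, integral_const_mul]
  calc ∫ x, (P.bondCurrent N k x) ^ 2 * ρ x ≤ T * ∫ x, G x.1 * ρ x := step1
    _ ≤ T * (2 * (∫ x, (x.1 l - x.1 k) ^ 2 * ρ x) + 2 * β ^ 2 * ∫ x, (x.1 l - x.1 k) ^ 6 * ρ x) :=
        mul_le_mul_of_nonneg_left step2 hT.le
    _ = _ := by ring

/-- **Sum over the bonds**: `∑_{bonds} ∫ j_k² e^{-H/T} ≤ N Z (2T² + 384 β²T³/(lam ω₂))`, `Z = ∫ e^{-H/T}`,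
for every `N` — the total static current fluctuation is extensive with an `N`-independent rate. [folklore] -/
theorem pinnedChain_sum_integral_sq_bondCurrent_le (hω : 0 < ω₂) (hl : 0 < lam) (hβ : 0 < β) (γ : ℝ) (N : ℕ)
    {T : ℝ} (hT : 0 < T) :
    (∑ k : Fin N, ∑ l : Fin N, if l.val = k.val + 1 then
        ∫ x, ((pinnedChain ω₂ lam β γ).bondCurrent N k x) ^ 2 * (pinnedChain ω₂ lam β γ).gibbsDensity N T x else 0) ≤
      N * (∫ x, (pinnedChain ω₂ lam β γ).gibbsDensity N T x) * (2 * T ^ 2 + 384 * β ^ 2 * T ^ 3 / (lam * ω₂)) := by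
  set P := pinnedChain ω₂ lam β γ with hP
  set ρ := P.gibbsDensity N T with hρ
  set Z : ℝ := ∫ x, ρ x with hZ
  set S2 : ℝ := ∑ k : Fin N, ∑ l : Fin N, if l.val = k.val + 1 then ∫ x, (x.1 l - x.1 k) ^ 2 * ρ x else 0 with hS2
  set S6 : ℝ := ∑ k : Fin N, ∑ l : Fin N, if l.val = k.val + 1 then ∫ x, (x.1 l - x.1 k) ^ 6 * ρ x else 0 with hS6
  set Q2 : ℝ := ∑ i : Fin N, ∫ x, x.1 i ^ 2 * ρ x with hQ2
  set Q6 : ℝ := ∑ i : Fin N, ∫ x, x.1 i ^ 6 * ρ x with hQ6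
  obtain ⟨hV1, hV2⟩ := pinnedChain_virial_two hω hl hβ.le γ N hT
  have hV6 := pinnedChain_virial_six hω hl hβ.le γ N hT
  have hB6 := pinnedChain_bond_six_le hω hl hβ γ N hT
  -- termwise bound and summation
  have hterm : (∑ k : Fin N, ∑ l : Fin N, if l.val = k.val + 1 then ∫ x, (P.bondCurrent N k x) ^ 2 * ρ x else 0) ≤
      2 * T * S2 + 2 * T * β ^ 2 * S6 := by
    calc (∑ k : Fin N, ∑ l : Fin N, if l.val = k.val + 1 then ∫ x, (P.bondCurrent N k x) ^ 2 * ρ x else 0)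
        ≤ ∑ k : Fin N, ∑ l : Fin N, if l.val = k.val + 1 then
            (2 * T * (∫ x, (x.1 l - x.1 k) ^ 2 * ρ x) + 2 * T * β ^ 2 * ∫ x, (x.1 l - x.1 k) ^ 6 * ρ x) else 0 := by
          refine Finset.sum_le_sum fun k _ => Finset.sum_le_sum fun l _ => ?_
          split_ifs with h
          · exact pinnedChain_integral_sq_bondCurrent_mul_gibbsDensity_le hω hl.le hβ γ N hT h
          · exact le_rfl
      _ = 2 * T * S2 + 2 * T * β ^ 2 * S6 := by
          simp only [hS2, hS6, Finset.mul_sum, ← Finset.sum_add_distrib]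
          refine Finset.sum_congr rfl fun k _ => Finset.sum_congr rfl fun l _ => ?_
          split_ifs <;> simp
  -- `Q6 ≤ 3 T Q2 / lam`, `ω₂ Q2 ≤ N T Z`
  have hQ2 : 0 ≤ Q2 := Finset.sum_nonneg fun i _ => integral_nonneg fun x =>
    mul_nonneg (sq_nonneg _) (P.gibbsDensity_pos N T x).le
  have hQ6le : lam * ω₂ * Q6 ≤ 3 * T * (N * T * Z) := by
    calc lam * ω₂ * Q6 = ω₂ * (lam * Q6) := by ring
      _ ≤ ω₂ * (3 * T * Q2) := mul_le_mul_of_nonneg_left hV6 hω.le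
      _ = 3 * T * (ω₂ * Q2) := by ring
      _ ≤ 3 * T * (N * T * Z) := mul_le_mul_of_nonneg_left hV1 (by positivity)
  have hlw : 0 < lam * ω₂ := mul_pos hl hω
  have hQ6le' : Q6 ≤ 3 * T * (N * T * Z) / (lam * ω₂) := by
    rw [le_div_iff₀ hlw]; linarith
  have hS6le : S6 ≤ 64 * (3 * T * (N * T * Z) / (lam * ω₂)) := hB6.trans (by linarith)
  calc _ ≤ 2 * T * S2 + 2 * T * β ^ 2 * S6 := hterm
    _ ≤ 2 * T * (N * T * Z) + 2 * T * β ^ 2 * (64 * (3 * T * (N * T * Z) / (lam * ω₂))) := by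
        have h1 : 2 * T * S2 ≤ 2 * T * (N * T * Z) := mul_le_mul_of_nonneg_left hV2 (by positivity)
        have h2 : 2 * T * β ^ 2 * S6 ≤ 2 * T * β ^ 2 * (64 * (3 * T * (N * T * Z) / (lam * ω₂))) :=
          mul_le_mul_of_nonneg_left hS6le (by positivity)
        linarith
    _ = N * Z * (2 * T ^ 2 + 384 * β ^ 2 * T ^ 3 / (lam * ω₂)) := by
        field_simp
        ring

/-- **`N`-uniform second moment of the current at some bond.** For the pinned anharmonic chain (all parameters
`> 0`) and every `N ≥ 2` there is a bond `(i, i+1)` with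
`∫ j_i² dμ_T ≤ 4T² + 768 β²T³/(lam ω₂)` — an `N`-INDEPENDENT constant (average of the extensive bound
`pinnedChain_sum_integral_sq_bondCurrent_le` over the `N − 1 ≥ N/2` bonds).  This is the static input of any
bulk-bond window law for `V_N(b,t)` (items (S)/(S_lc) of route BondHeatUncertainty). [folklore] -/
theorem pinnedChain_exists_bond_sq_bondCurrent_le (hω : 0 < ω₂) (hl : 0 < lam) (hβ : 0 < β) (γ : ℝ) {N : ℕ}
    (hN : 2 ≤ N) {T : ℝ} (hT : 0 < T) :
    ∃ i : Fin N, i.val + 1 < N ∧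
      ∫ z, ((pinnedChain ω₂ lam β γ).bondCurrent N i z) ^ 2 ∂((pinnedChain ω₂ lam β γ).gibbsMeasure N T) ≤
        4 * T ^ 2 + 768 * β ^ 2 * T ^ 3 / (lam * ω₂) := by
  set P := pinnedChain ω₂ lam β γ with hP
  set ρ := P.gibbsDensity N T with hρ
  set Z : ℝ := ∫ x, ρ x with hZdef
  have hZ : 0 < Z := integral_exp_pos (pinnedChain_integrable_gibbsDensity hω hl.le hβ.le γ N hT)
  set K₀ : ℝ := 2 * T ^ 2 + 384 * β ^ 2 * T ^ 3 / (lam * ω₂) with hK₀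
  have hK₀0 : 0 ≤ K₀ := by positivity
  set a : Fin N → ℝ := fun k => ∫ x, (P.bondCurrent N k x) ^ 2 * ρ x with ha
  have htot := pinnedChain_sum_integral_sq_bondCurrent_le hω hl hβ γ N hT
  rw [sum_sum_bond_eq N (fun k _ => a k)] at htot
  -- write `N = n + 1` and drop the last (dummy) index
  obtain ⟨n, rfl⟩ : ∃ n, N = n + 1 := ⟨N - 1, by omega⟩
  have hn : 1 ≤ n := by omega
  rw [Fin.sum_univ_castSucc] at htot
  have hlast : ¬ ((Fin.last n).val + 1 < n + 1) := by simp
  rw [dif_neg hlast, add_zero] at htot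
  have hcast : ∀ j : Fin n, (j.castSucc).val + 1 < n + 1 := fun j => by simp [j.isLt]
  have htot' : ∑ j : Fin n, a j.castSucc ≤ ((n + 1 : ℕ) : ℝ) * Z * K₀ := by
    refine le_trans (le_of_eq ?_) htot
    refine Finset.sum_congr rfl fun j _ => ?_
    rw [dif_pos (hcast j)]
  -- averaging over the `n` genuine bonds
  have hne : (Finset.univ : Finset (Fin n)).Nonempty := ⟨⟨0, by omega⟩, Finset.mem_univ _⟩
  have hn0 : (0:ℝ) < n := by exact_mod_cast (show 0 < n by omega)
  obtain ⟨j, -, hj⟩ := Finset.exists_le_of_sum_le hne (f := fun j => a j.castSucc)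
    (g := fun _ => ((n + 1 : ℕ) : ℝ) * Z * K₀ / n) (by
      rw [Finset.sum_const, Finset.card_univ, Fintype.card_fin, nsmul_eq_mul]
      rw [mul_div_cancel₀ _ hn0.ne']
      exact htot')
  refine ⟨j.castSucc, hcast j, ?_⟩
  -- `a_j ≤ (n+1) Z K₀ / n ≤ 2 Z K₀`, then divide by `Z`
  have hratio : ((n + 1 : ℕ) : ℝ) * Z * K₀ / n ≤ 2 * Z * K₀ := by
    rw [div_le_iff₀ hn0]
    have : ((n + 1 : ℕ) : ℝ) ≤ 2 * n := by
      have : (1:ℝ) ≤ n := by exact_mod_cast hn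
      push_cast; linarith
    have hZK : 0 ≤ Z * K₀ := mul_nonneg hZ.le hK₀0
    nlinarith
  have haj : a j.castSucc ≤ 2 * Z * K₀ := hj.trans hratio
  rw [P.integral_gibbsMeasure]
  change Z⁻¹ * a j.castSucc ≤ _
  rw [inv_mul_le_iff₀ hZ]
  calc a j.castSucc ≤ 2 * Z * K₀ := haj
    _ = Z * (4 * T ^ 2 + 768 * β ^ 2 * T ^ 3 / (lam * ω₂)) := by rw [hK₀]; ring

end Assembly

end Summit.AtomisticToContinuum.FouriersLaw.Theorems.LightConeBondHeat

end
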